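import Summits.HubbardSuperconductivity.HubbardSuperconductivity.Theorems.ThermalWedgeTwTipContinuationEdgeOrderCooperLog

/-!
# `DeformedRung` (stmt-HubbardSuperconductivity-1894, route `DeformationLadder`) — piece 1:
# the d-wave-weighted Cooper logarithm on tori of EVERY side (odd `L` included)

The every-side version of `cooperLog_dWave_ge` (Theorems/ThermalWedgeTwTipContinuationEdgeOrderCooperLog):
the regularised d-wave pair susceptibility of the free torus
`I_L(μ, D) = L⁻² Σ_k ĝ_d(k)² / (2 √((ε_L(k) − μ)² + D² ĝ_d(k)² + D⁴))`
satisfies `I_L(μ, D) ≥ (s⁶/(32768 π²)) · (log(s²L/64) − log(6DL/s))` for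
`−4 + 2s² ≤ μ ≤ s²/4`, `L ≥ 400/s²`, `3DL ≥ 2s` and EVERY parity of `L` (`cooperLog_dWave_ge_of_le`):
the window-rows harmonic walk of the even-side proof never used `μ ≤ 0` beyond `μ ≤ s²/4`, and the
`(π,π)` particle–hole shift (the only place evenness entered, for `μ > 0`) is not needed below the
slightly positive ceiling `s²/4` — which is all the canonical rung at densities `1 − δ < 1` consumes.
Consequence: for every target `M` and cap `D₁ > 0` a gap buffer `D ≤ min(D₁, 1/100)` with
`I_L(μ,D) ≥ M` for all `μ ∈ [−4+2s², s²/4]`, eventually in `L` (`exists_gap_cooperLog_all`).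
Folklore (the Cooper logarithm; Salmhofer 1999 §4.5.4 for its thermal form).
-/

noncomputable section

namespace Summit.HubbardSuperconductivity.DeformationLadder.DeformedRung

open Finset Real
open Literature.MathematicalPhysics.QuantumLattice Literature.Probability.LatticeModels
open Summit.HubbardSuperconductivity.TwTipContinuation.IsogapTransport

variable {L : ℕ} [NeZero L]

/-- **The weighted Cooper logarithm up to the ceiling `μ ≤ s²/4`, every side `L`.** For
`0 < s ≤ 1`, `0 < D ≤ 1`, `L ≥ 400/s²`, `3DL ≥ 2s` and `−4 + 2s² ≤ μ ≤ s²/4`: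
`(s⁶/(32768π²))(log(s²L/64) − log(6DL/s)) ≤ L⁻² Σ_k ĝ_d(k)²/(2√((ε_L(k)−μ)² + D²ĝ_d(k)² + D⁴))`.
Same window-rows harmonic walk as `cooperLog_dWave_ge_of_nonpos`; no parity of `L` is used. [folklore] -/
theorem cooperLog_dWave_ge_of_le {s μ D : ℝ} (hs : 0 < s) (hs1 : s ≤ 1) (hD : 0 < D) (hD1 : D ≤ 1)
    (hL : 400 / s ^ 2 ≤ (L : ℝ)) (hDL : 2 * s ≤ 3 * D * L) (hμ1 : -4 + 2 * s ^ 2 ≤ μ) (hμ2 : μ ≤ s ^ 2 / 4) :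
    s ^ 6 / (32768 * π ^ 2) * (Real.log (s ^ 2 * L / 64) - Real.log (6 * D * L / s)) ≤
      ((L : ℝ) ^ 2)⁻¹ * ∑ k : TorusSite 2 L, dWaveGap k ^ 2 /
        (2 * Real.sqrt ((torusBand L k - μ) ^ 2 + D ^ 2 * dWaveGap k ^ 2 + D ^ 4)) := by
  have hπ := Real.pi_pos
  have hs2 : 0 < s ^ 2 := by positivity
  have hsL : 400 ≤ s ^ 2 * L := by rwa [div_le_iff₀ hs2, mul_comm] at hL
  have hLr : (0 : ℝ) < L := by nlinarith
  have hLpos : 0 < L := by exact_mod_cast hLr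
  have hs21 : s ^ 2 ≤ 1 := by nlinarith
  set Λ : ℝ := Real.log (s ^ 2 * L / 64) - Real.log (6 * D * L / s) with hΛ
  set G : TorusSite 2 L → ℝ := fun k => dWaveGap k ^ 2 /
    (2 * Real.sqrt ((torusBand L k - μ) ^ 2 + D ^ 2 * dWaveGap k ^ 2 + D ^ 4)) with hG
  have hGnn : ∀ k, 0 ≤ G k := fun k => dWaveSummand_nonneg μ D k
  clear_value Λ G
  rw [le_inv_mul_iff₀ (by positivity)]
  by_cases hΛ0 : Λ < 0
  · have : (L : ℝ) ^ 2 * (s ^ 6 / (32768 * π ^ 2) * Λ) ≤ 0 :=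
      mul_nonpos_of_nonneg_of_nonpos (by positivity) (mul_nonpos_of_nonneg_of_nonpos (by positivity) hΛ0.le)
    exact this.trans (Finset.sum_nonneg fun k _ => hGnn k)
  push Not at hΛ0
  -- the window rows
  set xm : ℝ := -1 + s ^ 2 / 4 - μ / 2 with hxm
  have ha1 : -1 + s ^ 2 / 8 ≤ xm := by rw [hxm]; linarith
  have ha2 : xm + s ^ 2 / 8 ≤ 1 := by rw [hxm]; nlinarith
  set W : Finset ℕ := (Finset.range (L / 2 + 1)).filter fun n : ℕ =>
    xm ≤ Real.cos (2 * π * (n : ℝ) / L) ∧ Real.cos (2 * π * (n : ℝ) / L) ≤ xm + s ^ 2 / 8 with hW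
  have hWcard : s ^ 2 * L / (32 * π) ≤ (W.card : ℝ) := card_windowRows_ge hs hs1 hL ha1 ha2
  have hWlt : ∀ n ∈ W, n < L := by
    intro n hn
    rw [hW, Finset.mem_filter, Finset.mem_range] at hn
    omega
  set WB : Finset (ZMod L) := W.image fun n : ℕ => (n : ZMod L) with hWB
  have hinj : Set.InjOn (fun n : ℕ => (n : ZMod L)) ↑W := by
    intro n hn m hm h
    have := congrArg ZMod.val h
    rwa [ZMod.val_cast_of_lt (hWlt n hn), ZMod.val_cast_of_lt (hWlt m hm)] at this
  have hWBcard : (WB.card : ℝ) = W.card := by rw [hWB, Finset.card_image_of_injOn hinj]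
  -- each window row carries `κ Λ`
  have hrow : ∀ b ∈ WB, s ^ 4 / 64 * ((L : ℝ) / (16 * π)) * Λ ≤ ∑ a : ZMod L, G ![a, b] := by
    intro b hb
    rw [hWB, Finset.mem_image] at hb
    obtain ⟨n, hn, rfl⟩ := hb
    have hn2 := (Finset.mem_filter.1 hn).2
    rw [hΛ, hG]
    apply windowRow_sum_ge hs hs1 hD hD1 hL hDL hμ1
    · rw [ZMod.val_cast_of_lt (hWlt n hn)]; exact hn2.1
    · rw [ZMod.val_cast_of_lt (hWlt n hn)]; linarith [hn2.2]
  -- the chain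
  calc (L : ℝ) ^ 2 * (s ^ 6 / (32768 * π ^ 2) * Λ)
      = s ^ 2 * L / (32 * π) * (s ^ 4 / 64 * ((L : ℝ) / (16 * π)) * Λ) := by field_simp; ring
    _ ≤ (WB.card : ℝ) * (s ^ 4 / 64 * ((L : ℝ) / (16 * π)) * Λ) := by
        rw [hWBcard]; exact mul_le_mul_of_nonneg_right hWcard (by positivity)
    _ = ∑ b ∈ WB, s ^ 4 / 64 * ((L : ℝ) / (16 * π)) * Λ := by rw [Finset.sum_const, nsmul_eq_mul]
    _ ≤ ∑ b ∈ WB, ∑ a : ZMod L, G ![a, b] := Finset.sum_le_sum hrow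
    _ ≤ ∑ b : ZMod L, ∑ a : ZMod L, G ![a, b] :=
        Finset.sum_le_sum_of_subset_of_nonneg (Finset.subset_univ _) fun b _ _ =>
          Finset.sum_nonneg fun a _ => hGnn _
    _ = ∑ k, G k := (sum_torusSite_two_eq G).symm

omit [NeZero L] in
/-- **A capped gap buffer with a prescribed Cooper logarithm, every side `L`.** For `0 < s ≤ 1`,
every target `M` and every cap `D₁ > 0` there is `D ∈ (0, min(D₁, 1/100)]` such that, eventually in
`L` (all parities), `M ≤ L⁻² Σ_k ĝ_d(k)²/(2√((ε_L(k)−μ)² + D²ĝ_d(k)² + D⁴))` for all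
`μ ∈ [−4 + 2s², s²/4]`. [folklore] -/
theorem exists_gap_cooperLog_all {s : ℝ} (hs : 0 < s) (hs1 : s ≤ 1) (M : ℝ) {D₁ : ℝ} (hD₁ : 0 < D₁) :
    ∃ D : ℝ, 0 < D ∧ D ≤ D₁ ∧ D ≤ 1 / 100 ∧ ∃ L₁ : ℕ, ∀ (L : ℕ) [NeZero L], L₁ ≤ L → ∀ μ : ℝ,
      -4 + 2 * s ^ 2 ≤ μ → μ ≤ s ^ 2 / 4 →
      M ≤ ((L : ℝ) ^ 2)⁻¹ * ∑ k : TorusSite 2 L, dWaveGap k ^ 2 /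
        (2 * Real.sqrt ((torusBand L k - μ) ^ 2 + D ^ 2 * dWaveGap k ^ 2 + D ^ 4)) := by
  have hπ := Real.pi_pos
  set κ : ℝ := s ^ 6 / (32768 * π ^ 2) with hκ
  have hκ0 : 0 < κ := by positivity
  set D₀ : ℝ := s ^ 3 / 384 * Real.exp (-(max (M / κ) 0)) with hD₀
  have hD₀0 : 0 < D₀ := by positivity
  set D : ℝ := min D₀ (min D₁ (1 / 100)) with hD
  have hD0 : 0 < D := lt_min hD₀0 (lt_min hD₁ (by norm_num))
  have hDD₀ : D ≤ D₀ := min_le_left _ _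
  have hDD₁ : D ≤ D₁ := (min_le_right _ _).trans (min_le_left _ _)
  have hD100 : D ≤ 1 / 100 := (min_le_right _ _).trans (min_le_right _ _)
  have hD1 : D ≤ 1 := hD100.trans (by norm_num)
  refine ⟨D, hD0, hDD₁, hD100, ⌈max (400 / s ^ 2) (2 * s / (3 * D))⌉₊, fun L _ hL μ hμ1 hμ2 => ?_⟩
  have hL' : max (400 / s ^ 2) (2 * s / (3 * D)) ≤ (L : ℝ) := Nat.ceil_le.mp hL
  have hL1 : 400 / s ^ 2 ≤ (L : ℝ) := (le_max_left _ _).trans hL'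
  have hL2 : 2 * s / (3 * D) ≤ (L : ℝ) := (le_max_right _ _).trans hL'
  have hDL : 2 * s ≤ 3 * D * L := by
    rw [div_le_iff₀ (by positivity)] at hL2; linarith
  have hs2 : 0 < s ^ 2 := by positivity
  have hsL : 400 ≤ s ^ 2 * L := by rwa [div_le_iff₀ hs2, mul_comm] at hL1
  have hLr : (0 : ℝ) < L := by nlinarith
  have key := cooperLog_dWave_ge_of_le hs hs1 hD0 hD1 hL1 hDL hμ1 hμ2
  refine le_trans ?_ key
  -- `log(s²L/64) − log(6DL/s) = log(s³/(384 D)) ≥ log(s³/(384 D₀)) = max(M/κ, 0) ≥ M/κ`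
  have hlog : max (M / κ) 0 ≤ Real.log (s ^ 2 * L / 64) - Real.log (6 * D * L / s) := by
    rw [← Real.log_div (by positivity) (by positivity)]
    have e1 : s ^ 2 * (L : ℝ) / 64 / (6 * D * L / s) = s ^ 3 / (384 * D) := by
      field_simp
      ring
    have e2 : s ^ 3 / (384 * D₀) = Real.exp (max (M / κ) 0) := by
      rw [hD₀, Real.exp_neg]
      field_simp
    have hle : s ^ 3 / (384 * D₀) ≤ s ^ 3 / (384 * D) := by
      gcongr
    rw [e1]
    calc max (M / κ) 0 = Real.log (s ^ 3 / (384 * D₀)) := by rw [e2, Real.log_exp]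
      _ ≤ Real.log (s ^ 3 / (384 * D)) := Real.log_le_log (by positivity) hle
  rw [← hκ]
  have : M / κ ≤ max (M / κ) 0 := le_max_left _ _
  rw [div_le_iff₀ hκ0] at this
  nlinarith
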